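import Summits.NavierStokesRegularity.FunctionalMining.TopEigDanskin
import HarnessLib

/-!
# FunctionalMining — Jensen's inequality for the top Rayleigh value; constant top vectors survive averaging

Search for candidate a priori estimates; no regularity claim. Cell `pub-nsfunc`, prove seat
(gen 21). Kernel form of the no-go seat's kernel candidate K-a (`NoGo/STAGING.md`; the Jensen step of
F1 PART I Proposition 4 / (4′) "constant selections survive mollification", pen, countersigned in the
cell — not a cited fact), in the abstract form that covers every mollification: for a weight `w ≥ 0`
on a measure space and an integrable tensor field `F : Y → ℝ^{d×d}`,

* `TopEig.apply_integral_coord`, `TopEig.quad_integral` — coordinates and the Rayleigh form pass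
  under the Bochner integral: `eᵀ(∫ G)e = ∫ eᵀG e`;
* **`TopEig.lam_integral_smul_le`** (Jensen) — `λ(∫ w F) ≤ ∫ w · λ∘F` (`λ` is a supremum of linear
  forms);
* **`TopEig.lam_integral_smul_eq_of_const_top`**, `TopEig.mem_topEigSet_integral_smul` (Prop. 4′) — if
  ONE constant unit vector `e` is a top vector of `F(y)` for a.e. `y` with `w(y) ≠ 0`, then `e` is a top
  vector of the average and Jensen is an equality: `λ(∫ w F) = ∫ w · λ∘F = eᵀ(∫ w F)e`.

On the torus with `w = ρ_ε(x − ·)` (`ρ_ε ≥ 0`, `∫ρ_ε = 1`) and `F = S(v)`: `λ₁(S_ε(x)) ≤ (ρ_ε * λ₁)(x)`,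
with equality and `e ∈ E₁(S_ε(x))` whenever `e ∈ E₁(S(y))` on the `ε`-ball around `x` — wells and
`[0,1]`-profile twin walls stay free under mollification (F1 PART I §2, Examples (i)–(ii)). The
identification `S(ρ_ε * v) = ρ_ε * S(v)` (derivatives commute with convolution) is not part of this
file. [ours; folklore convex analysis]
-/

noncomputable section

open MeasureTheory Set

namespace Summit.NavierStokesRegularity.FunctionalMining

namespace TopEig

variable {d : Type*} [Fintype d] [DecidableEq d] [Nonempty d]
variable {Y : Type*} [MeasurableSpace Y] {μ : Measure Y}

/-! ## 1. Coordinates and the Rayleigh form under the integral -/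

omit [DecidableEq d] [Nonempty d] in
/-- Coordinates pass under the Bochner integral in `ℝ^{d×d}`. [folklore] -/
theorem apply_integral_coord {G : Y → EuclideanSpace ℝ (d × d)} (hG : Integrable G μ) (p : d × d) :
    (∫ y, G y ∂μ) p = ∫ y, G y p ∂μ := by
  have h := (EuclideanSpace.proj p : EuclideanSpace ℝ (d × d) →L[ℝ] ℝ).integral_comp_comm hG
  exact h.symm

omit [DecidableEq d] [Nonempty d] in
/-- Coordinates of an integrable tensor field are integrable. [folklore] -/
theorem integrable_coord {G : Y → EuclideanSpace ℝ (d × d)} (hG : Integrable G μ) (p : d × d) :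
    Integrable (fun y => G y p) μ :=
  (EuclideanSpace.proj p : EuclideanSpace ℝ (d × d) →L[ℝ] ℝ).integrable_comp hG

omit [DecidableEq d] [Nonempty d] in
/-- The Rayleigh form of a fixed vector is integrable along an integrable tensor field. [folklore] -/
theorem integrable_quad {G : Y → EuclideanSpace ℝ (d × d)} (hG : Integrable G μ) (e : d → ℝ) :
    Integrable (fun y => quad (G y) e) μ := by
  unfold quad
  refine integrable_finsetSum _ fun i _ => integrable_finsetSum _ fun j _ => ?_
  exact ((integrable_coord hG (i, j)).const_mul (e i)).mul_const (e j)

omit [DecidableEq d] [Nonempty d] in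
/-- **The Rayleigh form passes under the integral**: `eᵀ(∫ G)e = ∫ eᵀG(y)e`. [folklore] -/
theorem quad_integral {G : Y → EuclideanSpace ℝ (d × d)} (hG : Integrable G μ) (e : d → ℝ) :
    quad (∫ y, G y ∂μ) e = ∫ y, quad (G y) e ∂μ := by
  unfold quad
  rw [integral_finsetSum _ fun i _ => integrable_finsetSum _ fun j _ =>
    ((integrable_coord hG (i, j)).const_mul (e i)).mul_const (e j)]
  refine Finset.sum_congr rfl fun i _ => ?_
  rw [integral_finsetSum _ fun j _ => ((integrable_coord hG (i, j)).const_mul (e i)).mul_const (e j)]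
  refine Finset.sum_congr rfl fun j _ => ?_
  rw [integral_mul_const, integral_const_mul, apply_integral_coord hG]

/-! ## 2. Jensen's inequality for `λ` -/

omit [DecidableEq d] [Nonempty d] in
/-- Pointwise: `w · eᵀFe ≤ w · λ(F)` for `w ≥ 0` and unit `e`. [folklore] -/
theorem mul_quad_le_mul_lam {w : ℝ} (hw : 0 ≤ w) (F : EuclideanSpace ℝ (d × d)) {e : d → ℝ}
    (he : e ∈ unitSphere d) : w * quad F e ≤ w * lam F :=
  mul_le_mul_of_nonneg_left (quad_le_lam F he) hw

/-- **Jensen's inequality for the top Rayleigh value.** For a weight `w ≥ 0` and a tensor field `F`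
with `w F` and `w · λ∘F` integrable: `λ(∫ w F) ≤ ∫ w · λ∘F`. [folklore; F1 PART I Prop. 4′, Jensen step] -/
theorem lam_integral_smul_le {w : Y → ℝ} {F : Y → EuclideanSpace ℝ (d × d)} (hw : ∀ y, 0 ≤ w y)
    (hint : Integrable (fun y => w y • F y) μ) (hlam : Integrable (fun y => w y * lam (F y)) μ) :
    lam (∫ y, w y • F y ∂μ) ≤ ∫ y, w y * lam (F y) ∂μ := by
  refine lam_le fun e he => ?_
  rw [quad_integral hint]
  refine integral_mono (integrable_quad hint e) hlam fun y => ?_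
  show quad (w y • F y) e ≤ w y * lam (F y)
  rw [quad_smul]
  exact mul_quad_le_mul_lam (hw y) (F y) he

/-! ## 3. Constant top vectors survive averaging (Prop. 4′) -/

omit [DecidableEq d] [Nonempty d] in
/-- If a fixed unit vector `e` is a top vector of `F(y)` for a.e. `y` with `w(y) ≠ 0`, then
`eᵀ(∫ w F)e = ∫ w · λ∘F`. [folklore; F1 PART I Prop. 4′] -/
theorem quad_integral_smul_eq_of_const_top {w : Y → ℝ} {F : Y → EuclideanSpace ℝ (d × d)} {e : d → ℝ}
    (hint : Integrable (fun y => w y • F y) μ) (he : ∀ᵐ y ∂μ, w y ≠ 0 → e ∈ topEigSet (F y)) :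
    quad (∫ y, w y • F y ∂μ) e = ∫ y, w y * lam (F y) ∂μ := by
  rw [quad_integral hint]
  refine integral_congr_ae ?_
  filter_upwards [he] with y hy
  show quad (w y • F y) e = w y * lam (F y)
  rw [quad_smul]
  by_cases hw : w y = 0
  · rw [hw, zero_mul, zero_mul]
  · rw [(hy hw).2]

/-- **Constant top vectors survive averaging (F1 PART I Prop. 4′).** If `w ≥ 0`, `w F` and `w · λ∘F`
are integrable, and ONE fixed unit vector `e` is a top vector of `F(y)` for a.e. `y` with `w(y) ≠ 0`, then
Jensen is an equality: `λ(∫ w F) = ∫ w · λ∘F`. [folklore; F1 PART I Prop. 4′] -/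
theorem lam_integral_smul_eq_of_const_top {w : Y → ℝ} {F : Y → EuclideanSpace ℝ (d × d)} {e : d → ℝ}
    (he0 : e ∈ unitSphere d) (hw : ∀ y, 0 ≤ w y) (hint : Integrable (fun y => w y • F y) μ)
    (hlam : Integrable (fun y => w y * lam (F y)) μ)
    (he : ∀ᵐ y ∂μ, w y ≠ 0 → e ∈ topEigSet (F y)) :
    lam (∫ y, w y • F y ∂μ) = ∫ y, w y * lam (F y) ∂μ := by
  refine le_antisymm (lam_integral_smul_le hw hint hlam) ?_
  rw [← quad_integral_smul_eq_of_const_top hint he]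
  exact quad_le_lam _ he0

/-- … and `e` is a top vector of the average: `e ∈ E(∫ w F)`. [folklore; F1 PART I Prop. 4′] -/
theorem mem_topEigSet_integral_smul {w : Y → ℝ} {F : Y → EuclideanSpace ℝ (d × d)} {e : d → ℝ}
    (he0 : e ∈ unitSphere d) (hw : ∀ y, 0 ≤ w y) (hint : Integrable (fun y => w y • F y) μ)
    (hlam : Integrable (fun y => w y * lam (F y)) μ)
    (he : ∀ᵐ y ∂μ, w y ≠ 0 → e ∈ topEigSet (F y)) :
    e ∈ topEigSet (∫ y, w y • F y ∂μ) :=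
  ⟨he0, by rw [quad_integral_smul_eq_of_const_top hint he, lam_integral_smul_eq_of_const_top he0 hw hint hlam he]⟩

/-! ## 4. The unweighted form (probability / finite measures) -/

/-- **Jensen, unweighted**: for an integrable tensor field on a probability space,
`λ(∫ F) ≤ ∫ λ∘F`. [folklore] -/
theorem lam_integral_le [IsProbabilityMeasure μ] {F : Y → EuclideanSpace ℝ (d × d)}
    (hint : Integrable F μ) : lam (∫ y, F y ∂μ) ≤ ∫ y, lam (F y) ∂μ := by
  have hlam : Integrable (fun y => lam (F y)) μ := by
    refine Integrable.mono' hint.norm (continuous_lam.comp_aestronglyMeasurable hint.aestronglyMeasurable)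
      (ae_of_all _ fun y => ?_)
    rw [Real.norm_eq_abs]
    exact abs_lam_le_norm (F y)
  have h := lam_integral_smul_le (w := fun _ => (1 : ℝ)) (F := F) (μ := μ) (fun _ => zero_le_one)
    (by simpa only [one_smul] using hint) (by simpa only [one_mul] using hlam)
  simpa only [one_smul, one_mul] using h

/-- **Constant top vectors survive averaging, unweighted**: on a probability space, if a fixed unit `e`
is a top vector of `F(y)` for a.e. `y`, then `λ(∫ F) = ∫ λ∘F` and `e ∈ E(∫ F)`. [folklore; F1 PART I
Prop. 4′] -/
theorem lam_integral_eq_of_const_top [IsProbabilityMeasure μ] {F : Y → EuclideanSpace ℝ (d × d)}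
    {e : d → ℝ} (he0 : e ∈ unitSphere d) (hint : Integrable F μ)
    (he : ∀ᵐ y ∂μ, e ∈ topEigSet (F y)) :
    lam (∫ y, F y ∂μ) = ∫ y, lam (F y) ∂μ ∧ e ∈ topEigSet (∫ y, F y ∂μ) := by
  have hlam : Integrable (fun y => lam (F y)) μ := by
    refine Integrable.mono' hint.norm (continuous_lam.comp_aestronglyMeasurable hint.aestronglyMeasurable)
      (ae_of_all _ fun y => ?_)
    rw [Real.norm_eq_abs]
    exact abs_lam_le_norm (F y)
  have hint1 : Integrable (fun y => (1 : ℝ) • F y) μ := by simpa only [one_smul] using hint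
  have hlam1 : Integrable (fun y => (1 : ℝ) * lam (F y)) μ := by simpa only [one_mul] using hlam
  have he1 : ∀ᵐ y ∂μ, (1 : ℝ) ≠ 0 → e ∈ topEigSet (F y) := by
    filter_upwards [he] with y hy _ using hy
  have h1 := lam_integral_smul_eq_of_const_top he0 (fun _ => zero_le_one) hint1 hlam1 he1
  have h2 := mem_topEigSet_integral_smul he0 (fun _ => zero_le_one) hint1 hlam1 he1
  simp only [one_smul, one_mul] at h1 h2
  exact ⟨h1, h2⟩

/-! ## 5. On the torus: mollified tensor fields -/

section Torus

variable {n : Type*} [Fintype n]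

/-- **Jensen under mollification on `T^n`**: for a continuous kernel `ρ ≥ 0` and a continuous tensor
field `S`, `λ(∫ ρ(x − y) S(y) dy) ≤ ∫ ρ(x − y) λ(S(y)) dy` at every `x`. [folklore; F1 PART I Prop. 4′] -/
theorem lam_mollify_le {ρ : UnitAddTorus n → ℝ} {S : UnitAddTorus n → EuclideanSpace ℝ (d × d)}
    (hρ : Continuous ρ) (hρ0 : ∀ z, 0 ≤ ρ z) (hS : Continuous S) (x : UnitAddTorus n) :
    lam (∫ y, ρ (x - y) • S y) ≤ ∫ y, ρ (x - y) * lam (S y) := by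
  have hρx : Continuous fun y => ρ (x - y) := hρ.comp (continuous_const.sub continuous_id)
  exact lam_integral_smul_le (fun y => hρ0 _) (hρx.smul hS).integrable_unitAddTorus
    (hρx.mul (continuous_lam.comp hS)).integrable_unitAddTorus

/-- **Constant top vectors survive mollification on `T^n` (F1 PART I Prop. 4′)**: if moreover a fixed
unit vector `e` is a top vector of `S(y)` wherever `ρ(x − y) ≠ 0`, then
`λ(∫ ρ(x − y) S(y) dy) = ∫ ρ(x − y) λ(S(y)) dy` and `e` is a top vector of the mollified tensor at `x`.
[folklore; F1 PART I Prop. 4′] -/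
theorem lam_mollify_eq_of_const_top {ρ : UnitAddTorus n → ℝ}
    {S : UnitAddTorus n → EuclideanSpace ℝ (d × d)} {e : d → ℝ} (he0 : e ∈ unitSphere d)
    (hρ : Continuous ρ) (hρ0 : ∀ z, 0 ≤ ρ z) (hS : Continuous S) (x : UnitAddTorus n)
    (he : ∀ y, ρ (x - y) ≠ 0 → e ∈ topEigSet (S y)) :
    lam (∫ y, ρ (x - y) • S y) = ∫ y, ρ (x - y) * lam (S y) ∧
      e ∈ topEigSet (∫ y, ρ (x - y) • S y) := by
  have hρx : Continuous fun y => ρ (x - y) := hρ.comp (continuous_const.sub continuous_id)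
  have hint : Integrable (fun y => ρ (x - y) • S y) volume := (hρx.smul hS).integrable_unitAddTorus
  have hlam : Integrable (fun y => ρ (x - y) * lam (S y)) volume :=
    (hρx.mul (continuous_lam.comp hS)).integrable_unitAddTorus
  exact ⟨lam_integral_smul_eq_of_const_top he0 (fun y => hρ0 _) hint hlam (ae_of_all _ he),
    mem_topEigSet_integral_smul he0 (fun y => hρ0 _) hint hlam (ae_of_all _ he)⟩

end Torus

end TopEig

end Summit.NavierStokesRegularity.FunctionalMining

end
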